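/-
HONEST FRAMING: certified error envelopes and provably optimal rounding/accumulation schemes for
low-precision formats under stated cost models; every table by two implementations; no hardware
or vendor claims.
-/
import Summits.Ventures.CertifiedArithmetic.LowPrec.OptDemotionCovers

/-!
# The demotion law (Theorem T8), part 6c: the eight UNFILTERED candidate lines of a node (`CoversU`)

Support for parts 6c′/6c″/6d (OPTIMA.md §B T8(b)(iii″), Conjecture D for every tree from GOOD-ACTIVE).
Part 5a's `Covers` credits a node `a·b` (computed value `v ∈ [σ, 2σ)`) with the transposed lines
`F3 = σ(u + μ_a + uλ_b) + α_b (v - σ)`, `F3m`, `F4`, `F4m` only when their slope is at most their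
intercept (the hereditary-good family of part 5).  In the FULL family `allLines` (part 6a) every
transform of every child line is a member, so the goodness side conditions are dropped: `CoversU … T`
says that `T` is below one of the eight lines, unconditionally.  This file proves symmetry,
monotonicity, the eliminator, and `Covers → CoversU`.
-/

namespace Summit.Ventures.CertifiedArithmetic.LowPrec.Opt.Demotion

/-- `T` is covered by one of the eight candidate lines of the node at scale `σ`, value `v` — the
UNFILTERED version of `Covers` (no goodness side conditions on `F3`, `F3m`, `F4`, `F4m`). -/
def CoversU (u σ v Ma Aa La Mb Ab Lb T : ℚ) : Prop :=
  T ≤ (Aa + u + u * Mb) * σ + La * (v - σ) ∨ T ≤ (Ma + u + u * Mb) * σ ∨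
  T ≤ (Ab + u + u * Ma) * σ + Lb * (v - σ) ∨ T ≤ (Mb + u + u * Ma) * σ ∨
  T ≤ (u + Ma + u * Lb) * σ + Ab * (v - σ) ∨ T ≤ (u + Ma) * σ + Mb * (v - σ) ∨
  T ≤ (u + Mb + u * La) * σ + Aa * (v - σ) ∨ T ≤ (u + Mb) * σ + Ma * (v - σ)

namespace CoversU

variable {u σ v Ma Aa La Mb Ab Lb T : ℚ}

/-- Line F1 covers. -/
theorem F1 (h : T ≤ (Aa + u + u * Mb) * σ + La * (v - σ)) : CoversU u σ v Ma Aa La Mb Ab Lb T :=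
  Or.inl h
/-- Line F1m covers. -/
theorem F1m (h : T ≤ (Ma + u + u * Mb) * σ) : CoversU u σ v Ma Aa La Mb Ab Lb T := Or.inr (Or.inl h)
/-- Line F2 covers. -/
theorem F2 (h : T ≤ (Ab + u + u * Ma) * σ + Lb * (v - σ)) : CoversU u σ v Ma Aa La Mb Ab Lb T :=
  Or.inr (Or.inr (Or.inl h))
/-- Line F2m covers. -/
theorem F2m (h : T ≤ (Mb + u + u * Ma) * σ) : CoversU u σ v Ma Aa La Mb Ab Lb T :=
  Or.inr (Or.inr (Or.inr (Or.inl h)))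
/-- Line F3 covers (no side condition). -/
theorem F3 (h : T ≤ (u + Ma + u * Lb) * σ + Ab * (v - σ)) : CoversU u σ v Ma Aa La Mb Ab Lb T :=
  Or.inr (Or.inr (Or.inr (Or.inr (Or.inl h))))
/-- Line F3m covers. -/
theorem F3m (h : T ≤ (u + Ma) * σ + Mb * (v - σ)) : CoversU u σ v Ma Aa La Mb Ab Lb T :=
  Or.inr (Or.inr (Or.inr (Or.inr (Or.inr (Or.inl h)))))
/-- Line F4 covers. -/
theorem F4 (h : T ≤ (u + Mb + u * La) * σ + Aa * (v - σ)) : CoversU u σ v Ma Aa La Mb Ab Lb T :=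
  Or.inr (Or.inr (Or.inr (Or.inr (Or.inr (Or.inr (Or.inl h))))))
/-- Line F4m covers. -/
theorem F4m (h : T ≤ (u + Mb) * σ + Ma * (v - σ)) : CoversU u σ v Ma Aa La Mb Ab Lb T :=
  Or.inr (Or.inr (Or.inr (Or.inr (Or.inr (Or.inr (Or.inr h))))))

/-- Swapping the two children permutes the eight lines. -/
theorem swap (h : CoversU u σ v Mb Ab Lb Ma Aa La T) : CoversU u σ v Ma Aa La Mb Ab Lb T := by
  rcases h with h | h | h | h | h | h | h | h
  · exact F2 h
  · exact F2m h
  · exact F1 h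
  · exact F1m h
  · exact F4 h
  · exact F4m h
  · exact F3 h
  · exact F3m h

/-- `CoversU` is downward closed in `T`. -/
theorem mono {T' : ℚ} (hT : T' ≤ T) (h : CoversU u σ v Ma Aa La Mb Ab Lb T) :
    CoversU u σ v Ma Aa La Mb Ab Lb T' := by
  rcases h with h | h | h | h | h | h | h | h
  · exact F1 (hT.trans h)
  · exact F1m (hT.trans h)
  · exact F2 (hT.trans h)
  · exact F2m (hT.trans h)
  · exact F3 (hT.trans h)
  · exact F3m (hT.trans h)
  · exact F4 (hT.trans h)
  · exact F4m (hT.trans h)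

/-- The filtered cover of part 5a implies the unfiltered one. -/
theorem of_covers (h : Covers u σ v Ma Aa La Mb Ab Lb T) : CoversU u σ v Ma Aa La Mb Ab Lb T := by
  rcases h with h | h | h | h | ⟨-, h⟩ | ⟨-, h⟩ | ⟨-, h⟩ | ⟨-, h⟩
  · exact F1 h
  · exact F1m h
  · exact F2 h
  · exact F2m h
  · exact F3 h
  · exact F3m h
  · exact F4 h
  · exact F4m h

/-- EXPORT: whichever line covers, `T ≤ σ·(intercept) + (slope)·(v - σ)` for one of the eight
transforms; packaged as an eliminator into any goal. -/
theorem elim {P : Prop} (h : CoversU u σ v Ma Aa La Mb Ab Lb T)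
    (h1 : T ≤ (Aa + u + u * Mb) * σ + La * (v - σ) → P)
    (h1m : T ≤ (Ma + u + u * Mb) * σ → P)
    (h2 : T ≤ (Ab + u + u * Ma) * σ + Lb * (v - σ) → P)
    (h2m : T ≤ (Mb + u + u * Ma) * σ → P)
    (h3 : T ≤ (u + Ma + u * Lb) * σ + Ab * (v - σ) → P)
    (h3m : T ≤ (u + Ma) * σ + Mb * (v - σ) → P)
    (h4 : T ≤ (u + Mb + u * La) * σ + Aa * (v - σ) → P)
    (h4m : T ≤ (u + Mb) * σ + Ma * (v - σ) → P) : P := by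
  rcases h with h | h | h | h | h | h | h | h
  · exact h1 h
  · exact h1m h
  · exact h2 h
  · exact h2m h
  · exact h3 h
  · exact h3m h
  · exact h4 h
  · exact h4m h

end CoversU

end Summit.Ventures.CertifiedArithmetic.LowPrec.Opt.Demotion
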